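import Mathlib.MeasureTheory.Integral.IntegralEqImproper
import Mathlib.Analysis.SpecialFunctions.Gaussian.GaussianIntegral
import Mathlib.Analysis.SpecialFunctions.ExpDeriv
import Mathlib.Analysis.SpecialFunctions.Pow.Real
import HarnessLib

/-!
# The interacting φ⁴ one-site law: integrability and the virial / score Stein identities

HONEST FRAMING: exact (Metropolis-corrected) sampling algorithms for lattice gauge theory;
figures of merit are autocorrelation/cost numbers at stated couplings and volumes; no
continuum-physics claim.

Venture `LatticeQCDFlow` (cell pub-lqcd), sub-topic `Exactness`; FANOUT row 9 (`eng-latcore`).  NEW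
WORK of the cell.  Fourth file of the Stein series (`SteinCircle`, `SteinRealLine`, `SteinProduct`).

One site `φ = x` of the 2-d lattice φ⁴ field in the AKS2019 normalisation
(`S = Σ_x [Σ_μ (φ(x+μ) − φ(x))² + m² φ² + λ φ⁴]`), conditioned on its neighbours, has the law
`∝ e^{−S(x)}` with `S(x) = λ x⁴ + b x² + c x`, `b = 4 + m²`, `c = −2 n` (`n` = neighbour sum) — ANY
real `b`, `c` and `λ > 0`.  `latflow.core.schwinger_dyson.residual_phi4_2d` (0.2.5) writes per site the
VIRIAL residual `1 − x S′(x)` and the SCORE residual `S″(x) − S′(x)²`; here both are shown to integrate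
to zero against `e^{−S}` for every `λ > 0`, `b`, `c`:

* `quartic_lower_bound` — `λx⁴ + bx² + cx ≥ x² − K` with `K = (λc² + (b−2)²)/(4λ)`
  (two squares: `4λ(S − x² + K) = (2λx² + b − 2)² + λ(2x + c)²`);
* `integrable_pow_mul_exp_neg_quartic` — `x ↦ x^k e^{−S(x)}` is integrable on `ℝ` for every `k : ℕ`
  (domination by `e^K · |x|^k e^{−x²}`, Mathlib's Gaussian moments);
* **`phi4_site_virial`** — `∫ (1 − x (4λx³ + 2bx + c)) e^{−(λx⁴ + bx² + cx)} dx = 0`;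
* **`phi4_site_score`** — `∫ ((12λx² + 2b) − (4λx³ + 2bx + c)²) e^{−(λx⁴ + bx² + cx)} dx = 0`.

(`λ = 0`, `b > 0` is `SteinRealLine.gaussian_virial` / `gaussian_score`.)  Not typed: the sum over
sites under the joint law (that is `SteinProduct.integral_prod_eq_zero_of_forall_inner` applied per
site) and anything about statistical power.
-/

namespace Summit.Ventures.LatticeQCDFlow.Exactness

open Real MeasureTheory

/-- The one-site quartic action `S(x) = λ x⁴ + b x² + c x`. -/
theorem quartic_lower_bound {lam : ℝ} (hlam : 0 < lam) (b c x : ℝ) :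
    x ^ 2 - (lam * c ^ 2 + (b - 2) ^ 2) / (4 * lam) ≤ lam * x ^ 4 + b * x ^ 2 + c * x := by
  have h4 : 0 < 4 * lam := by linarith
  have key : 0 ≤ (2 * lam * x ^ 2 + (b - 2)) ^ 2 + lam * (2 * x + c) ^ 2 := by positivity
  have expand : (2 * lam * x ^ 2 + (b - 2)) ^ 2 + lam * (2 * x + c) ^ 2
      = 4 * lam * (lam * x ^ 4 + b * x ^ 2 + c * x - x ^ 2) + (lam * c ^ 2 + (b - 2) ^ 2) := by ring
  rw [expand] at key
  have hdiv : (lam * c ^ 2 + (b - 2) ^ 2) / (4 * lam)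
      = (lam * c ^ 2 + (b - 2) ^ 2) * (1 / (4 * lam)) := by ring
  have hpos : 0 < 1 / (4 * lam) := by positivity
  -- multiply the inequality `-(λc²+(b-2)²) ≤ 4λ(S - x²)` by 1/(4λ) > 0
  have key2 : -(lam * c ^ 2 + (b - 2) ^ 2) * (1 / (4 * lam))
      ≤ 4 * lam * (lam * x ^ 4 + b * x ^ 2 + c * x - x ^ 2) * (1 / (4 * lam)) :=
    mul_le_mul_of_nonneg_right (by linarith) hpos.le
  have hsimp : 4 * lam * (lam * x ^ 4 + b * x ^ 2 + c * x - x ^ 2) * (1 / (4 * lam))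
      = lam * x ^ 4 + b * x ^ 2 + c * x - x ^ 2 := by field_simp
  rw [hsimp] at key2
  rw [hdiv]
  linarith

/-- `e^{−S(x)} ≤ e^{K} e^{−x²}` with `K = (λc² + (b−2)²)/(4λ)`. -/
theorem exp_neg_quartic_le {lam : ℝ} (hlam : 0 < lam) (b c x : ℝ) :
    Real.exp (-(lam * x ^ 4 + b * x ^ 2 + c * x))
      ≤ Real.exp ((lam * c ^ 2 + (b - 2) ^ 2) / (4 * lam)) * Real.exp (-1 * x ^ 2) := by
  rw [← Real.exp_add]
  apply Real.exp_le_exp.mpr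
  have h := quartic_lower_bound hlam b c x
  linarith

/-- `x ↦ |x|^k e^{−x²}` is integrable on `ℝ` (Gaussian moments, from Mathlib's `rpow` lemma). -/
theorem integrable_abs_pow_mul_exp_neg_sq (k : ℕ) :
    Integrable (fun x : ℝ => |x| ^ k * Real.exp (-1 * x ^ 2)) := by
  have h := integrable_rpow_mul_exp_neg_mul_sq (b := 1) one_pos (s := k)
    (by have : (0 : ℝ) ≤ k := Nat.cast_nonneg k; linarith)
  have h2 := h.norm
  refine h2.congr ?_
  filter_upwards with x
  rw [Real.norm_eq_abs, abs_mul, abs_of_pos (Real.exp_pos _), Real.rpow_natCast, abs_pow]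

/-- **Integrability of the one-site φ⁴ moments.**  For `λ > 0` and every `k : ℕ`, `b`, `c`:
`x ↦ x^k e^{−(λx⁴ + bx² + cx)}` is integrable on `ℝ`. -/
theorem integrable_pow_mul_exp_neg_quartic {lam : ℝ} (hlam : 0 < lam) (b c : ℝ) (k : ℕ) :
    Integrable (fun x : ℝ => x ^ k * Real.exp (-(lam * x ^ 4 + b * x ^ 2 + c * x))) := by
  set K : ℝ := (lam * c ^ 2 + (b - 2) ^ 2) / (4 * lam) with hK
  have hdom := (integrable_abs_pow_mul_exp_neg_sq k).const_mul (Real.exp K)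
  refine hdom.mono' ?_ ?_
  · exact ((continuous_pow k).mul (by fun_prop : Continuous fun x : ℝ =>
      Real.exp (-(lam * x ^ 4 + b * x ^ 2 + c * x)))).aestronglyMeasurable
  · filter_upwards with x
    rw [Real.norm_eq_abs, abs_mul, abs_of_pos (Real.exp_pos _), abs_pow]
    have hle := exp_neg_quartic_le hlam b c x
    have hxk : 0 ≤ |x| ^ k := by positivity
    calc |x| ^ k * Real.exp (-(lam * x ^ 4 + b * x ^ 2 + c * x))
        ≤ |x| ^ k * (Real.exp K * Real.exp (-1 * x ^ 2)) := mul_le_mul_of_nonneg_left hle hxk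
      _ = Real.exp K * (|x| ^ k * Real.exp (-1 * x ^ 2)) := by ring

/-- The derivative of the one-site action: `S′(x) = 4λx³ + 2bx + c`. -/
theorem hasDerivAt_quartic (lam b c x : ℝ) :
    HasDerivAt (fun y => lam * y ^ 4 + b * y ^ 2 + c * y) (4 * lam * x ^ 3 + 2 * b * x + c) x := by
  have h1 := ((hasDerivAt_id x).pow 4).const_mul lam
  have h2 := ((hasDerivAt_id x).pow 2).const_mul b
  have h3 := (hasDerivAt_id x).const_mul c
  have h := (h1.add h2).add h3
  simp only [id] at h
  exact h.congr_deriv (by ring)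

/-- **The φ⁴ one-site VIRIAL identity.**  For every `λ > 0`, `b`, `c`:
`∫ (1 − x S′(x)) e^{−S(x)} dx = 0`, `S(x) = λx⁴ + bx² + cx` — the zero-mean statement behind the
engine's `obs_sd_virial` column (per site, conditionally on the neighbours; `b = 4 + m²`, `c = −2n`). -/
theorem phi4_site_virial {lam : ℝ} (hlam : 0 < lam) (b c : ℝ) :
    ∫ x : ℝ, (1 - x * (4 * lam * x ^ 3 + 2 * b * x + c)) * Real.exp (-(lam * x ^ 4 + b * x ^ 2 + c * x))
      = 0 := by
  have I := fun k => integrable_pow_mul_exp_neg_quartic hlam b c k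
  -- f = x e^{-S}, f' = (1 - x S') e^{-S}
  have hf : Integrable (fun x : ℝ => x * Real.exp (-(lam * x ^ 4 + b * x ^ 2 + c * x))) := by
    refine (I 1).congr ?_; filter_upwards with x; rw [pow_one]
  have hint : Integrable (fun x : ℝ =>
      (1 - (4 * lam * x ^ 3 + 2 * b * x + c) * x) * Real.exp (-(lam * x ^ 4 + b * x ^ 2 + c * x))) := by
    have h := (((I 0).sub ((I 4).const_mul (4 * lam))).sub ((I 2).const_mul (2 * b))).sub ((I 1).const_mul c)
    refine h.congr ?_
    filter_upwards with x
    simp only [Pi.sub_apply, pow_zero, pow_one, one_mul]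
    ring
  have hmain := integral_eq_zero_of_hasDerivAt_of_integrable
    (f := fun x => x * Real.exp (-(lam * x ^ 4 + b * x ^ 2 + c * x))) (fun x => ?_) hint hf
  · have hpt : (fun x : ℝ => (1 - x * (4 * lam * x ^ 3 + 2 * b * x + c)) * Real.exp (-(lam * x ^ 4 + b * x ^ 2 + c * x)))
        = fun x => (1 - (4 * lam * x ^ 3 + 2 * b * x + c) * x) * Real.exp (-(lam * x ^ 4 + b * x ^ 2 + c * x)) := by
      funext x; ring
    rw [hpt]; exact hmain
  · have h1 : HasDerivAt (fun y => -(lam * y ^ 4 + b * y ^ 2 + c * y)) (-(4 * lam * x ^ 3 + 2 * b * x + c)) x :=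
      (hasDerivAt_quartic lam b c x).neg
    have h2 := ((hasDerivAt_id x).mul h1.exp)
    simp only [id] at h2
    exact h2.congr_deriv (by ring)

/-- **The φ⁴ one-site SCORE identity.**  For every `λ > 0`, `b`, `c`:
`∫ (S″(x) − S′(x)²) e^{−S(x)} dx = 0` with `S″ = 12λx² + 2b` — the zero-mean statement behind the
engine's `obs_sd_score` column. -/
theorem phi4_site_score {lam : ℝ} (hlam : 0 < lam) (b c : ℝ) :
    ∫ x : ℝ, ((12 * lam * x ^ 2 + 2 * b) - (4 * lam * x ^ 3 + 2 * b * x + c) ^ 2)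
        * Real.exp (-(lam * x ^ 4 + b * x ^ 2 + c * x)) = 0 := by
  have I := fun k => integrable_pow_mul_exp_neg_quartic hlam b c k
  -- f = S' e^{-S}, f' = (S'' - S'^2) e^{-S}
  have hf : Integrable (fun x : ℝ => (4 * lam * x ^ 3 + 2 * b * x + c)
      * Real.exp (-(lam * x ^ 4 + b * x ^ 2 + c * x))) := by
    have h := (((I 3).const_mul (4 * lam)).add ((I 1).const_mul (2 * b))).add ((I 0).const_mul c)
    refine h.congr ?_
    filter_upwards with x
    simp only [Pi.add_apply, pow_zero, pow_one, one_mul]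
    ring
  have hint : Integrable (fun x : ℝ => ((12 * lam * x ^ 2 + 2 * b) - (4 * lam * x ^ 3 + 2 * b * x + c)
      * (4 * lam * x ^ 3 + 2 * b * x + c)) * Real.exp (-(lam * x ^ 4 + b * x ^ 2 + c * x))) := by
    have h := ((((((((I 2).const_mul (12 * lam)).add ((I 0).const_mul (2 * b))).sub ((I 6).const_mul (16 * lam ^ 2))).sub
      ((I 4).const_mul (16 * lam * b))).sub ((I 3).const_mul (8 * lam * c))).sub ((I 2).const_mul (4 * b ^ 2))).sub
      ((I 1).const_mul (4 * b * c))).sub ((I 0).const_mul (c ^ 2))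
    refine h.congr ?_
    filter_upwards with x
    simp only [Pi.add_apply, Pi.sub_apply, pow_zero, pow_one, one_mul]
    ring
  have hmain := integral_eq_zero_of_hasDerivAt_of_integrable
    (f := fun x => (4 * lam * x ^ 3 + 2 * b * x + c) * Real.exp (-(lam * x ^ 4 + b * x ^ 2 + c * x)))
    (fun x => ?_) hint hf
  · have hpt : (fun x : ℝ => ((12 * lam * x ^ 2 + 2 * b) - (4 * lam * x ^ 3 + 2 * b * x + c) ^ 2)
          * Real.exp (-(lam * x ^ 4 + b * x ^ 2 + c * x)))
        = fun x => ((12 * lam * x ^ 2 + 2 * b) - (4 * lam * x ^ 3 + 2 * b * x + c)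
          * (4 * lam * x ^ 3 + 2 * b * x + c)) * Real.exp (-(lam * x ^ 4 + b * x ^ 2 + c * x)) := by
      funext x; ring
    rw [hpt]; exact hmain
  · have h1 : HasDerivAt (fun y => -(lam * y ^ 4 + b * y ^ 2 + c * y)) (-(4 * lam * x ^ 3 + 2 * b * x + c)) x :=
      (hasDerivAt_quartic lam b c x).neg
    have hS' : HasDerivAt (fun y => 4 * lam * y ^ 3 + 2 * b * y + c) (12 * lam * x ^ 2 + 2 * b) x := by
      have g1 := ((hasDerivAt_id x).pow 3).const_mul (4 * lam)
      have g2 := (hasDerivAt_id x).const_mul (2 * b)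
      have g := (g1.add g2).add (hasDerivAt_const x c)
      simp only [id] at g
      exact g.congr_deriv (by ring)
    have h2 := hS'.mul h1.exp
    exact h2.congr_deriv (by ring)

end Summit.Ventures.LatticeQCDFlow.Exactness
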